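import Summits.QuantumFields.BalabanUV.T4Continuum.Support.DirichletStarVectorTower
import Summits.QuantumFields.BalabanUV.T4Continuum.Support.RegionGaugeSliceOrthRegion

/-!
# T⁴ programme, spine node NE2 (U1a), sub-row Δ1 «NE2⁰-Dirichlet» — THE RESOLVENT SPLIT OF THE FAITHFUL REGION OPERATOR:
# `Δ_a(Ω₀) = Δ_loc(Ω₀) − B̂·K̂⁻¹·B̂ᴴ` (LOCAL operator minus a RANK-|S| gauge sandwich), `G = G̃ + G·(B̂K̂⁻¹B̂ᴴ)·G̃`, and the
# TWO-LEVEL TRANSFER `‖G′J − JG‖ ≤ (1+κ′)(1+κ)·‖G̃′J − JG̃‖ + ‖G′‖‖G‖·‖E′J − JE‖` (owner item O15-a «Δ1-VEC-W3-RESOLVENT-SPLIT»)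

Row NE2 OWNER (unit `b2b-balaban-t4-ne2-p1`, gen 15), file 1 of O15-a.  After gen 14 (O14-a: W1 on every coordinate box, p235372) and the
crew's reductions (leaf-06-g6 `DirichletStarRenormBoxTower.towerLimitRate_star_renorm_box_of_compressed`, p236822) the box star towers of the
[B9]-faithful `U = 1` region vector operator `Δ_a(Ω₀) = curlRᴴcurlR + ∂_Ω·R(Ω₀)·∂_Ωᴴ + a n^d·avgRᴴavgR` (`RegionGaugeFixedVector.regionDeltaA`)
converge at rate `(√L)⁻¹` MODULO ONE binder: King's compressed injected law `hinjK : ‖G_{k+1}·J_k − J_k·G_k‖ ≤ C₁θ^k` on boxes (O14-b′).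
Gen 14 cut O14-b′ into commutator pieces (P-lap/flux)/(P-mass)/(P-gauge) with budgets (R) for `G = Δ_a(Ω₀)⁻¹` ITSELF — the gauge piece
and the Hessian budgets of the NONLOCAL operator being the hard ones.  THIS FILE re-cuts the binder STRUCTURALLY (kernel algebra, any region):

 * §1 ABSTRACT (`RegionGaugeSlice.gaugeFixed` data): `R = 1 − P` gives **`gaugeFixed = localFixed − B·(Q′G′²Q′ᴴ)⁻¹·Bᴴ`** with the LOCAL
   operator `localFixed Cu Dg Qv a := CuᴴCu + Dg·Dgᴴ + a·QvᴴQv` and the GAUGE COLUMNS `gaugeB Dg G Qs := Dg·G′·Q′ᴴ` (one column per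
   block: the gradient of the scalar region solution with a block-constant source); `Re⟨A, Δ_a A⟩ ≤ Re⟨A, Δ_loc A⟩` (‖R‖ ≤ 1), so every
   coercivity constant of `Δ_a` is one of `Δ_loc`; `nsq (B c) ≤ ‖G′‖·θ·nsq c` from `DgᴴDg ≤ Δ′` and `Q′Q′ᴴ = θ·1`.
 * §2 GENERIC RESOLVENT ALGEBRA: `X = Y − E` ⟹ `X⁻¹ = Y⁻¹ + X⁻¹EY⁻¹ = Y⁻¹ + Y⁻¹EX⁻¹`; at two levels with any planting `J`
   **`X′⁻¹J − JX⁻¹ = (1 + X′⁻¹E′)·(Y′⁻¹J − JY⁻¹)·(1 + EX⁻¹) + X′⁻¹·(E′J − JE)·X⁻¹`** (`injected_split`) and its norm form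
   `opNorm_injected_le_split`; for sandwiches `E = B·Kᵢ·Bᴴ` the exact split
   `E′J − JE = B′Kᵢ′(JᴴB′ − B)ᴴ + ((B′ − JB)Kᵢ′ + JB(Kᵢ′ − Kᵢ))Bᴴ` and its norm form (`opNorm_sandwich_comm_le`).
 * §3 THE REGION INSTANCE: `regionDeltaLoc n M a S := localFixed curlR gradR avgR (a·n^d)`, `regionBh n M a′ S := √(n^d)·gradR·GOm·QOmᴴ`;
   **`regionDeltaA = regionDeltaLoc − regionBh·KcompR⁻¹·regionBhᴴ`** (`KcompR` = Bałaban-normalised `Q′G′²Q′ᴴ`, ‖KcompR⁻¹‖ ≤ σ₀⁻² level-free,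
   leaf-07-g5 p222542); `‖regionBh‖ ≤ √(γ′⁻¹)` (γ′ = `gammaPs d a′`); `Coercive regionDeltaA γ ⟹ Coercive regionDeltaLoc γ`; the gauge
   sandwich against the propagator is bounded: `‖(B̂K̂⁻¹B̂ᴴ)·G‖, ‖G·(B̂K̂⁻¹B̂ᴴ)‖ ≤ γ′⁻¹σ₀⁻²γ⁻¹` (level-free on boxes, where γ = γ⋆ by W1).
   File 2 (`Support/RegionGaugeResolventTower`) runs §2 along the star tower: `hinjK` ⟸ the injected law of the LOCAL operator ∧ the two-level
   convergence of the |S| gauge columns ∧ of `KcompR⁻¹` — (P-gauge) and the Hessian budgets of the nonlocal operator are no longer needed.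

WHY `Δ_loc` (recorded): on an `AtMostOneNeighbour` region the exterior-flux rows `(∂∂ᴴ)_{VV} − ∂_Ω∂_Ωᴴ` are DIAGONAL, so `Δ_loc` is
componentwise — component ν = the scalar Laplacian on `Ω ∪ (Ω − e_ν)` (Neumann rows on the ν-faces, Dirichlet on the others) + line mass.

HONEST FRAMING (T4-DAG p. 1).  Model level (`U = 1`, ONE region, ONE averaging scale, finite torus, operator norm); [folklore] algebra over landed
modules; nothing printed is a hypothesis; `hinjK` NOT proved here; NE2 (U1a) NOT proved; spine PROVED 0/9 unchanged; NOT [B9] (3.16)/(3.23)–(3.27)/(3.42)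
as printed; NOT infinite volume / mass gap / Clay.  HONEST DEPENDENCY: continuum YM on T⁴ ⇐ BetaPertH ∧ nine spine estimates (0/9 proved);
BetaPertH ⇐ (D1) ∧ (D4) ∧ CAP+tail; G-an2-4 gates asym, D1 and NE2/3/4.  No `sorry`.
-/

noncomputable section

open scoped BigOperators ComplexConjugate Matrix Matrix.Norms.L2Operator

namespace Summit.QuantumFields.BalabanUV.T4Continuum.RegionGaugeResolventSplit

open Literature.MathematicalPhysics.QuantumFieldTheory.Balaban1983to89.B5Prop11Plancherel (Tor fine)
open Literature.MathematicalPhysics.QuantumFieldTheory.Balaban1983to89.B5Prop11Lower (nsq nsq_nonneg nsq_mulVec_le)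
open Summit.QuantumFields.BalabanUV.T4Continuum
open Summit.QuantumFields.BalabanUV.T4Continuum.SubtypeCompression (Coercive isUnit_det_of_coercive opNorm_inv_le_of_coercive)
open Summit.QuantumFields.BalabanUV.T4Continuum.BalabanBlockPoincare (nsq_mulVec_le_rect)
open Summit.QuantumFields.BalabanUV.T4Continuum.ScalarBlockPoincare (nsq_smul)
open Summit.QuantumFields.BalabanUV.T4Continuum.ScalarAveragedPropagator (gammaPs gammaPs_pos opNorm_le_of_nsq_le_rect)
open Summit.QuantumFields.BalabanUV.T4Continuum.ScalarAveragedCompression (sigma0 sigma0_pos)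
open Summit.QuantumFields.BalabanUV.T4Continuum.RegionGaugeProjection (gramK gaugeP gaugeR opNorm_gaugeR_le nsq_QH_mulVec)
open Summit.QuantumFields.BalabanUV.T4Continuum.RegionGaugeSlice (gaugeFixed form_gaugeFixed form_gram re_form_le_opNorm)
open Summit.QuantumFields.BalabanUV.T4Continuum.RegionScalarCompression (QOm GOm KcompR GOm_isHermitian DOm_mul_GOm
  inv_gramK_region_eq opNorm_KcompR_inv_le isUnit_det_KcompR)
open Summit.QuantumFields.BalabanUV.T4Continuum.RegionGaugeFixedVector (starReg curlR gradR avgR regionDeltaA)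
open Summit.QuantumFields.BalabanUV.T4Continuum.RegionGaugeSliceOrthRegion (QOm_mul_conjTranspose nsq_gradR_le_form_DOm)
open Summit.QuantumFields.BalabanUV.T4Continuum.DirichletStarVectorTower (regionDeltaA_isHermitian)
open Summit.QuantumFields.BalabanUV.Beta.GAN24.DirichletBoxCompression (DOm opNorm_inv_DOm_le)
open Summit.QuantumFields.BalabanUV.Beta.GAN24.DirichletBoxTrace (blockReg)

variable {d : ℕ}

/-! ## §1 Abstract: the local operator, the gauge columns, the split, the forms -/

section Abstract

variable {m v w u uv : Type*} [Fintype m] [DecidableEq m] [Fintype v] [DecidableEq v] [Fintype u] [DecidableEq u]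
  [Fintype w] [Fintype uv]
variable (Cu : Matrix w v ℂ) (Dg : Matrix v m ℂ) (G : Matrix m m ℂ) (Qs : Matrix u m ℂ) (Qv : Matrix uv v ℂ) (a : ℝ)

/-- **THE LOCAL OPERATOR** `Δ_loc = CᴴC + D·Dᴴ + a·QᴴQ` — Bałaban's `Δ_a` with the gauge projection `R` replaced by `1`
(curl part + FULL region-divergence part + mass). [cite: Balaban1985BackgroundPropagators, (3.26) p.395 (shape)] [folklore] -/
def localFixed : Matrix v v ℂ := Cuᴴ * Cu + Dg * Dgᴴ + (a : ℂ) • (Qvᴴ * Qv)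

/-- **THE GAUGE COLUMNS** `B = D·G′·Q′ᴴ`: one column per unit block — the gradient of the scalar region solution `G′Q′ᴴe_y`.
[cite: Balaban1985BackgroundPropagators, (3.25) p.394 (shape: G′Q′*)] [folklore] -/
def gaugeB : Matrix v u ℂ := Dg * G * Qsᴴ

omit [Fintype v] [DecidableEq v] in
/-- `Δ_a = Δ_loc − D·P·Dᴴ` (`R = 1 − P`). [folklore] -/
theorem gaugeFixed_eq_localFixed_sub :
    gaugeFixed Cu Dg G Qs Qv a = localFixed Cu Dg Qv a - Dg * gaugeP G Qs * Dgᴴ := by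
  unfold gaugeFixed localFixed gaugeR
  rw [Matrix.mul_sub, Matrix.sub_mul, Matrix.mul_one]
  abel

omit [DecidableEq m] [Fintype v] [DecidableEq v] in
/-- `D·P·Dᴴ = B·(Q′G′²Q′ᴴ)⁻¹·Bᴴ` for Hermitian `G′`. [folklore] -/
theorem Dg_gaugeP_DgH_eq (hG : G.IsHermitian) :
    Dg * gaugeP G Qs * Dgᴴ = gaugeB Dg G Qs * (gramK G Qs)⁻¹ * (gaugeB Dg G Qs)ᴴ := by
  unfold gaugeP gaugeB
  rw [Matrix.conjTranspose_mul, Matrix.conjTranspose_mul, Matrix.conjTranspose_conjTranspose, hG.eq]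
  simp only [Matrix.mul_assoc]

omit [Fintype v] [DecidableEq v] in
/-- **THE SPLIT** `Δ_a = Δ_loc − B·K⁻¹·Bᴴ`, `K = Q′G′²Q′ᴴ`. [folklore] -/
theorem gaugeFixed_eq_localFixed_sub_sandwich (hG : G.IsHermitian) :
    gaugeFixed Cu Dg G Qs Qv a = localFixed Cu Dg Qv a - gaugeB Dg G Qs * (gramK G Qs)⁻¹ * (gaugeB Dg G Qs)ᴴ := by
  rw [gaugeFixed_eq_localFixed_sub, Dg_gaugeP_DgH_eq Dg G Qs hG]

omit [DecidableEq m] [Fintype v] [DecidableEq v] in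
/-- `Δ_loc` is Hermitian (real coupling). [folklore] -/
theorem localFixed_isHermitian : (localFixed Cu Dg Qv a).IsHermitian := by
  unfold localFixed Matrix.IsHermitian
  rw [Matrix.conjTranspose_add, Matrix.conjTranspose_add, Matrix.conjTranspose_smul, Matrix.conjTranspose_mul,
    Matrix.conjTranspose_mul, Matrix.conjTranspose_mul, Matrix.conjTranspose_conjTranspose,
    Matrix.conjTranspose_conjTranspose, Matrix.conjTranspose_conjTranspose, Complex.star_def, Complex.conj_ofReal]

omit [DecidableEq m] [DecidableEq v] in
/-- `Re⟨A, Δ_loc A⟩ = ‖CA‖² + ‖DᴴA‖² + a‖QA‖²`. [folklore] -/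
theorem form_localFixed (A : v → ℂ) :
    (star A ⬝ᵥ (localFixed Cu Dg Qv a *ᵥ A)).re = nsq (Cu *ᵥ A) + nsq (Dgᴴ *ᵥ A) + a * nsq (Qv *ᵥ A) := by
  have hmid : star A ⬝ᵥ ((Dg * Dgᴴ) *ᵥ A) = ((nsq (Dgᴴ *ᵥ A) : ℝ) : ℂ) := by
    have h := form_gram (Dgᴴ) A
    rwa [Matrix.conjTranspose_conjTranspose] at h
  unfold localFixed
  rw [Matrix.add_mulVec, Matrix.add_mulVec, Matrix.smul_mulVec, dotProduct_add, dotProduct_add, dotProduct_smul,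
    form_gram, hmid, form_gram, smul_eq_mul, Complex.add_re, Complex.add_re, Complex.ofReal_re, Complex.ofReal_re,
    ← Complex.ofReal_mul, Complex.ofReal_re]

omit [DecidableEq v] in
/-- **`Δ_a ≤ Δ_loc` AS FORMS** (`‖R·DᴴA‖ ≤ ‖DᴴA‖` since `‖R‖ ≤ 1`). [folklore] -/
theorem form_gaugeFixed_le_form_localFixed (hG : G.IsHermitian) (hK : IsUnit (gramK G Qs).det) (A : v → ℂ) :
    (star A ⬝ᵥ (gaugeFixed Cu Dg G Qs Qv a *ᵥ A)).re ≤ (star A ⬝ᵥ (localFixed Cu Dg Qv a *ᵥ A)).re := by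
  rw [form_gaugeFixed Cu Dg G Qs Qv a hG hK, form_localFixed]
  have hR := opNorm_gaugeR_le G Qs hG hK
  have h1 : nsq (gaugeR G Qs *ᵥ (Dgᴴ *ᵥ A)) ≤ nsq (Dgᴴ *ᵥ A) := by
    refine (nsq_mulVec_le _ _).trans ?_
    have h2 : ‖gaugeR G Qs‖ ^ 2 ≤ 1 := by nlinarith [norm_nonneg (gaugeR G Qs)]
    nlinarith [nsq_nonneg (Dgᴴ *ᵥ A)]
  linarith

omit [DecidableEq v] in
/-- hence every coercivity constant of `Δ_a` is one of `Δ_loc`. [folklore] -/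
theorem coercive_localFixed_of (hG : G.IsHermitian) (hK : IsUnit (gramK G Qs).det) {γ : ℝ}
    (h : Coercive (gaugeFixed Cu Dg G Qs Qv a) γ) : Coercive (localFixed Cu Dg Qv a) γ :=
  fun A => (h A).trans (form_gaugeFixed_le_form_localFixed Cu Dg G Qs Qv a hG hK A)

omit [DecidableEq v] in
/-- **THE GAUGE COLUMNS ARE ENERGY-BOUNDED**: `DᴴD ≤ Δ′` as forms, `Δ′G′ = 1`, `Q′Q′ᴴ = θ·1` ⟹ `nsq (B c) ≤ ‖G′‖·θ·nsq c`. [folklore] -/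
theorem nsq_gaugeB_mulVec_le {Dp : Matrix m m ℂ} (hDG : Dp * G = 1)
    (hform : ∀ ψ : m → ℂ, nsq (Dg *ᵥ ψ) ≤ (star ψ ⬝ᵥ (Dp *ᵥ ψ)).re) {θ : ℝ}
    (hQ : Qs * Qsᴴ = (θ : ℂ) • (1 : Matrix u u ℂ)) (c : u → ℂ) :
    nsq (gaugeB Dg G Qs *ᵥ c) ≤ ‖G‖ * (θ * nsq c) := by
  set h := Qsᴴ *ᵥ c with hh
  have e0 : gaugeB Dg G Qs *ᵥ c = Dg *ᵥ (G *ᵥ h) := by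
    rw [hh, Matrix.mulVec_mulVec, Matrix.mulVec_mulVec]; rfl
  have h1 := hform (G *ᵥ h)
  have e1 : Dp *ᵥ (G *ᵥ h) = h := by rw [Matrix.mulVec_mulVec, hDG, Matrix.one_mulVec]
  rw [e1] at h1
  have h2 : (star (G *ᵥ h) ⬝ᵥ h).re ≤ ‖G‖ * nsq h := re_form_le_opNorm G h
  have h3 : nsq h = θ * nsq c := nsq_QH_mulVec Qs hQ c
  rw [e0, ← h3]
  exact h1.trans h2

end Abstract

/-! ## §2 Generic resolvent algebra: one level, two levels, the sandwich commutator -/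

section Resolvent

variable {v v' u : Type*} [Fintype v] [DecidableEq v] [Fintype v'] [DecidableEq v'] [Fintype u] [DecidableEq u]

/-- `X = Y − E` (both invertible) ⟹ `X⁻¹ = Y⁻¹ + X⁻¹·E·Y⁻¹`. [folklore] -/
theorem inv_eq_inv_add_left {X Y E : Matrix v v ℂ} (hX : IsUnit X.det) (hY : IsUnit Y.det) (hE : X = Y - E) :
    X⁻¹ = Y⁻¹ + X⁻¹ * E * Y⁻¹ := by
  have h1 : E = Y - X := by rw [hE, sub_sub_cancel]
  rw [h1, Matrix.mul_sub, Matrix.sub_mul, Matrix.mul_assoc X⁻¹ Y Y⁻¹, Matrix.mul_nonsing_inv Y hY, Matrix.mul_one,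
    Matrix.nonsing_inv_mul X hX, Matrix.one_mul]
  abel

/-- `X = Y − E` (both invertible) ⟹ `X⁻¹ = Y⁻¹ + Y⁻¹·E·X⁻¹`. [folklore] -/
theorem inv_eq_inv_add_right {X Y E : Matrix v v ℂ} (hX : IsUnit X.det) (hY : IsUnit Y.det) (hE : X = Y - E) :
    X⁻¹ = Y⁻¹ + Y⁻¹ * E * X⁻¹ := by
  have h1 : E = Y - X := by rw [hE, sub_sub_cancel]
  rw [h1, Matrix.mul_sub, Matrix.sub_mul, Matrix.mul_assoc Y⁻¹ X X⁻¹, Matrix.mul_nonsing_inv X hX, Matrix.mul_one,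
    Matrix.nonsing_inv_mul Y hY, Matrix.one_mul]
  abel

/-- `(1 + X⁻¹E)·Y⁻¹ = X⁻¹`. [folklore] -/
theorem one_add_mul_inv_eq {X Y E : Matrix v v ℂ} (hX : IsUnit X.det) (hY : IsUnit Y.det) (hE : X = Y - E) :
    (1 + X⁻¹ * E) * Y⁻¹ = X⁻¹ := by
  rw [Matrix.add_mul, Matrix.one_mul, ← inv_eq_inv_add_left hX hY hE]

/-- `Y⁻¹·(1 + EX⁻¹) = X⁻¹`. [folklore] -/
theorem inv_mul_one_add_eq {X Y E : Matrix v v ℂ} (hX : IsUnit X.det) (hY : IsUnit Y.det) (hE : X = Y - E) :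
    Y⁻¹ * (1 + E * X⁻¹) = X⁻¹ := by
  rw [Matrix.mul_add, Matrix.mul_one, ← Matrix.mul_assoc, ← inv_eq_inv_add_right hX hY hE]

/-- `‖E·X⁻¹‖ ≤ κ` ⟹ `‖1 + E·X⁻¹‖ ≤ 1 + κ` (and the mirror form). [folklore] -/
theorem opNorm_one_add_le {A : Matrix v v ℂ} {κ : ℝ} (h : ‖A‖ ≤ κ) : ‖(1 : Matrix v v ℂ) + A‖ ≤ 1 + κ := by
  have hone : ‖(1 : Matrix v v ℂ)‖ ≤ 1 := by
    rw [Matrix.cstar_norm_def, map_one]; exact ContinuousLinearMap.norm_id_le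
  exact (norm_add_le _ _).trans (add_le_add hone h)

/-- **THE TWO-LEVEL TRANSFER IDENTITY**: for `X = Y − E`, `X′ = Y′ − E′` (all four invertible) and any planting `J`,
`X′⁻¹J − JX⁻¹ = (1 + X′⁻¹E′)·(Y′⁻¹J − JY⁻¹)·(1 + EX⁻¹) + X′⁻¹·(E′J − JE)·X⁻¹`. [folklore] -/
theorem injected_split {X Y E : Matrix v v ℂ} {X' Y' E' : Matrix v' v' ℂ} (hX : IsUnit X.det) (hY : IsUnit Y.det) (hE : X = Y - E)
    (hX' : IsUnit X'.det) (hY' : IsUnit Y'.det) (hE' : X' = Y' - E') (J : Matrix v' v ℂ) :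
    X'⁻¹ * J - J * X⁻¹
      = (1 + X'⁻¹ * E') * (Y'⁻¹ * J - J * Y⁻¹) * (1 + E * X⁻¹) + X'⁻¹ * (E' * J - J * E) * X⁻¹ := by
  have h1 : (1 + X'⁻¹ * E') * Y'⁻¹ = X'⁻¹ := one_add_mul_inv_eq hX' hY' hE'
  have h2 : Y⁻¹ * (1 + E * X⁻¹) = X⁻¹ := inv_mul_one_add_eq hX hY hE
  have h3 : (1 + X'⁻¹ * E') * (Y'⁻¹ * J - J * Y⁻¹) * (1 + E * X⁻¹)
      = X'⁻¹ * J * (1 + E * X⁻¹) - (1 + X'⁻¹ * E') * J * X⁻¹ := by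
    rw [Matrix.mul_sub, Matrix.sub_mul, ← Matrix.mul_assoc (1 + X'⁻¹ * E') Y'⁻¹ J, h1,
      Matrix.mul_assoc (1 + X'⁻¹ * E') (J * Y⁻¹) (1 + E * X⁻¹), Matrix.mul_assoc J Y⁻¹ (1 + E * X⁻¹), h2,
      ← Matrix.mul_assoc (1 + X'⁻¹ * E') J X⁻¹]
  rw [h3]
  simp only [Matrix.mul_add, Matrix.add_mul, Matrix.mul_sub, Matrix.sub_mul, Matrix.mul_one, Matrix.one_mul, Matrix.mul_assoc]
  abel

/-- **THE TWO-LEVEL TRANSFER INEQUALITY**: `‖X′⁻¹J − JX⁻¹‖ ≤ (1+κ′)·‖Y′⁻¹J − JY⁻¹‖·(1+κ) + g′·‖E′J − JE‖·g` whenever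
`‖X′⁻¹E′‖ ≤ κ′`, `‖EX⁻¹‖ ≤ κ`, `‖X′⁻¹‖ ≤ g′`, `‖X⁻¹‖ ≤ g`. [folklore] -/
theorem opNorm_injected_le_split {X Y E : Matrix v v ℂ} {X' Y' E' : Matrix v' v' ℂ} (hX : IsUnit X.det) (hY : IsUnit Y.det)
    (hE : X = Y - E) (hX' : IsUnit X'.det) (hY' : IsUnit Y'.det) (hE' : X' = Y' - E') (J : Matrix v' v ℂ)
    {κ κ' g g' : ℝ} (hκ : ‖E * X⁻¹‖ ≤ κ) (hκ' : ‖X'⁻¹ * E'‖ ≤ κ') (hg : ‖X⁻¹‖ ≤ g) (hg' : ‖X'⁻¹‖ ≤ g') (hg0 : 0 ≤ g') :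
    ‖X'⁻¹ * J - J * X⁻¹‖ ≤ (1 + κ') * ‖Y'⁻¹ * J - J * Y⁻¹‖ * (1 + κ) + g' * ‖E' * J - J * E‖ * g := by
  have hκ0 : 0 ≤ 1 + κ' := le_trans (norm_nonneg _) (opNorm_one_add_le hκ')
  rw [injected_split hX hY hE hX' hY' hE' J]
  refine (norm_add_le _ _).trans (add_le_add ?_ ?_)
  · calc ‖(1 + X'⁻¹ * E') * (Y'⁻¹ * J - J * Y⁻¹) * (1 + E * X⁻¹)‖
        ≤ ‖(1 + X'⁻¹ * E') * (Y'⁻¹ * J - J * Y⁻¹)‖ * ‖1 + E * X⁻¹‖ := Matrix.l2_opNorm_mul _ _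
      _ ≤ ‖1 + X'⁻¹ * E'‖ * ‖Y'⁻¹ * J - J * Y⁻¹‖ * ‖1 + E * X⁻¹‖ :=
          mul_le_mul_of_nonneg_right (Matrix.l2_opNorm_mul _ _) (norm_nonneg _)
      _ ≤ (1 + κ') * ‖Y'⁻¹ * J - J * Y⁻¹‖ * (1 + κ) := by
          gcongr
          · exact opNorm_one_add_le hκ'
          · exact opNorm_one_add_le hκ
  · calc ‖X'⁻¹ * (E' * J - J * E) * X⁻¹‖ ≤ ‖X'⁻¹ * (E' * J - J * E)‖ * ‖X⁻¹‖ := Matrix.l2_opNorm_mul _ _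
      _ ≤ ‖X'⁻¹‖ * ‖E' * J - J * E‖ * ‖X⁻¹‖ := mul_le_mul_of_nonneg_right (Matrix.l2_opNorm_mul _ _) (norm_nonneg _)
      _ ≤ g' * ‖E' * J - J * E‖ * g := by gcongr

omit [DecidableEq v] [DecidableEq v'] [DecidableEq u] in
/-- **THE SANDWICH COMMUTATOR, EXACTLY**: for `E = B·Kᵢ·Bᴴ`, `E′ = B′·Kᵢ′·B′ᴴ`,
`E′J − JE = B′Kᵢ′·(JᴴB′ − B)ᴴ + ((B′ − JB)Kᵢ′ + JB(Kᵢ′ − Kᵢ))·Bᴴ`. [folklore] -/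
theorem sandwich_comm_eq (B : Matrix v u ℂ) (B' : Matrix v' u ℂ) (Ki Ki' : Matrix u u ℂ) (J : Matrix v' v ℂ) :
    B' * Ki' * B'ᴴ * J - J * (B * Ki * Bᴴ)
      = B' * Ki' * (Jᴴ * B' - B)ᴴ + ((B' - J * B) * Ki' + J * B * (Ki' - Ki)) * Bᴴ := by
  rw [Matrix.conjTranspose_sub, Matrix.conjTranspose_mul, Matrix.conjTranspose_conjTranspose]
  simp only [Matrix.add_mul, Matrix.mul_sub, Matrix.sub_mul, Matrix.mul_assoc]
  abel

omit [DecidableEq v'] in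
/-- **… AND ITS NORM FORM**: `‖E′J − JE‖ ≤ ‖B′‖‖Kᵢ′‖·‖JᴴB′ − B‖ + (‖B′ − JB‖·‖Kᵢ′‖ + ‖J‖‖B‖·‖Kᵢ′ − Kᵢ‖)·‖B‖`. [folklore] -/
theorem opNorm_sandwich_comm_le (B : Matrix v u ℂ) (B' : Matrix v' u ℂ) (Ki Ki' : Matrix u u ℂ) (J : Matrix v' v ℂ)
    {b b' ki εB εBt εK j : ℝ} (hb : ‖B‖ ≤ b) (hb' : ‖B'‖ ≤ b') (hki : ‖Ki'‖ ≤ ki) (hj : ‖J‖ ≤ j)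
    (hB : ‖B' - J * B‖ ≤ εB) (hBt : ‖Jᴴ * B' - B‖ ≤ εBt) (hK : ‖Ki' - Ki‖ ≤ εK)
    (hb0 : 0 ≤ b) (hb0' : 0 ≤ b') (hki0 : 0 ≤ ki) (hj0 : 0 ≤ j) (hεB : 0 ≤ εB) :
    ‖B' * Ki' * B'ᴴ * J - J * (B * Ki * Bᴴ)‖ ≤ b' * ki * εBt + (εB * ki + j * b * εK) * b := by
  rw [sandwich_comm_eq]
  have hBn : ‖Bᴴ‖ ≤ b := by rw [Matrix.l2_opNorm_conjTranspose]; exact hb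
  have hBtn : ‖(Jᴴ * B' - B)ᴴ‖ ≤ εBt := by rw [Matrix.l2_opNorm_conjTranspose]; exact hBt
  refine (norm_add_le _ _).trans (add_le_add ?_ ?_)
  · calc ‖B' * Ki' * (Jᴴ * B' - B)ᴴ‖ ≤ ‖B' * Ki'‖ * ‖(Jᴴ * B' - B)ᴴ‖ := Matrix.l2_opNorm_mul _ _
      _ ≤ ‖B'‖ * ‖Ki'‖ * ‖(Jᴴ * B' - B)ᴴ‖ := mul_le_mul_of_nonneg_right (Matrix.l2_opNorm_mul _ _) (norm_nonneg _)
      _ ≤ b' * ki * εBt := by gcongr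
  · have h1 : ‖(B' - J * B) * Ki' + J * B * (Ki' - Ki)‖ ≤ εB * ki + j * b * εK := by
      refine (norm_add_le _ _).trans (add_le_add ?_ ?_)
      · exact (Matrix.l2_opNorm_mul _ _).trans (by gcongr)
      · calc ‖J * B * (Ki' - Ki)‖ ≤ ‖J * B‖ * ‖Ki' - Ki‖ := Matrix.l2_opNorm_mul _ _
          _ ≤ ‖J‖ * ‖B‖ * ‖Ki' - Ki‖ := mul_le_mul_of_nonneg_right (Matrix.l2_opNorm_mul _ _) (norm_nonneg _)
          _ ≤ j * b * εK := by gcongr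
    have h0 : 0 ≤ εB * ki + j * b * εK :=
      add_nonneg (mul_nonneg hεB hki0) (mul_nonneg (mul_nonneg hj0 hb0) ((norm_nonneg _).trans hK))
    calc ‖((B' - J * B) * Ki' + J * B * (Ki' - Ki)) * Bᴴ‖ ≤ ‖(B' - J * B) * Ki' + J * B * (Ki' - Ki)‖ * ‖Bᴴ‖ :=
          Matrix.l2_opNorm_mul _ _
      _ ≤ (εB * ki + j * b * εK) * b := by gcongr

end Resolvent

/-! ## §3 The region instance: `Δ_a(Ω₀) = Δ_loc(Ω₀) − B̂·K̂⁻¹·B̂ᴴ`, with level-free bounds -/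

section Region

variable (n : ℕ) [NeZero n] (M : Fin d → ℕ) [hM : ∀ μ, NeZero (M μ)] (a a' : ℝ) (S : Tor M → Prop) [DecidablePred S]

/-- **THE LOCAL REGION OPERATOR** `Δ_loc(Ω₀) = curlRᴴcurlR + ∂_Ω∂_Ωᴴ + a n^d·avgRᴴavgR` on the star bonds (on an `AtMostOneNeighbour`
region: componentwise, component ν = the lattice Laplacian on `Ω ∪ (Ω − e_ν)` with Neumann rows on the ν-faces, Dirichlet on the others,
+ the line-averaging mass). [cite: Balaban1985BackgroundPropagators, (3.26) p.395 (shape)] [folklore] -/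
def regionDeltaLoc : Matrix {b // starReg n M S b} {b // starReg n M S b} ℂ :=
  localFixed (curlR n M S) (gradR n M S) (avgR n M S) (a * (n : ℝ) ^ d)

/-- **THE NORMALISED GAUGE COLUMNS** `B̂(Ω₀) = √(n^d)·∂_Ω·G′_Ω·Q′_Ωᴴ` (Bałaban's `n^{d/2}` normalisation of `Q′`, so that the scalar
planting maps `Q̂′_kᴴ` to `Q̂′_{k+1}ᴴ`). [cite: Balaban1985BackgroundPropagators, (3.25) p.394 (shape)] [folklore] -/
def regionBh : Matrix {b // starReg n M S b} {y // S y} ℂ :=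
  (((Real.sqrt ((n : ℝ) ^ d)) : ℝ) : ℂ) • gaugeB (gradR n M S) (GOm n M a' S) (QOm n M S)

/-- unfolding (definitional). [folklore] -/
theorem regionDeltaLoc_eq : regionDeltaLoc n M a S
    = (curlR n M S)ᴴ * curlR n M S + gradR n M S * (gradR n M S)ᴴ
        + ((a * (n : ℝ) ^ d : ℝ) : ℂ) • ((avgR n M S)ᴴ * avgR n M S) := rfl

omit [NeZero n] in
/-- `√(n^d)·√(n^d) = n^d` in `ℂ`. [folklore] -/
theorem sqrt_mul_sqrt_pow : ((((Real.sqrt ((n : ℝ) ^ d)) : ℝ) : ℂ)) * (((Real.sqrt ((n : ℝ) ^ d)) : ℝ) : ℂ) = (n : ℂ) ^ d := by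
  rw [← Complex.ofReal_mul, Real.mul_self_sqrt (pow_nonneg (Nat.cast_nonneg _) d)]
  push_cast; ring

omit [NeZero n] hM [DecidablePred S] in
/-- scalar bookkeeping: `(s•B)·Kᵢ·(s•B)ᴴ = B·((s·s)•Kᵢ)·Bᴴ` for real `s`. [folklore] -/
theorem smul_sandwich {p q : Type*} [Fintype p] [Fintype q] (B : Matrix p q ℂ) (Ki : Matrix q q ℂ) (s : ℝ) :
    ((s : ℂ) • B) * Ki * ((s : ℂ) • B)ᴴ = B * (((s : ℂ) * (s : ℂ)) • Ki) * Bᴴ := by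
  rw [Matrix.conjTranspose_smul, Complex.star_def, Complex.conj_ofReal, Matrix.smul_mul, Matrix.smul_mul, Matrix.mul_smul,
    smul_smul, Matrix.mul_smul, Matrix.smul_mul]

/-- **THE RESOLVENT SPLIT OF THE FAITHFUL OPERATOR**: `Δ_a(Ω₀) = Δ_loc(Ω₀) − B̂·KcompR⁻¹·B̂ᴴ` (`0 < a′`). [folklore] -/
theorem regionDeltaA_eq_loc_sub (ha' : 0 < a') :
    regionDeltaA n M a a' S = regionDeltaLoc n M a S - regionBh n M a' S * (KcompR n M a' S)⁻¹ * (regionBh n M a' S)ᴴ := by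
  unfold regionDeltaA regionDeltaLoc regionBh
  rw [gaugeFixed_eq_localFixed_sub_sandwich _ _ _ _ _ _ (GOm_isHermitian n M a' S), inv_gramK_region_eq n M a' S ha',
    smul_sandwich, sqrt_mul_sqrt_pow]

/-- `Δ_loc(Ω₀)` is Hermitian. [folklore] -/
theorem regionDeltaLoc_isHermitian : (regionDeltaLoc n M a S).IsHermitian := localFixed_isHermitian _ _ _ _

/-- **`Δ_a(Ω₀) ≤ Δ_loc(Ω₀)`**: every coercivity constant of the faithful operator is one of the local operator (`0 < a′`). [folklore] -/
theorem coercive_regionDeltaLoc_of (ha' : 0 < a') {γ : ℝ} (h : Coercive (regionDeltaA n M a a' S) γ) :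
    Coercive (regionDeltaLoc n M a S) γ :=
  coercive_localFixed_of _ _ _ _ _ _ (GOm_isHermitian n M a' S)
    (RegionScalarCompression.isUnit_det_gramK_region n M a' S ha') h

/-- hence `G̃(Ω₀) = Δ_loc(Ω₀)⁻¹` exists with `‖G̃‖ ≤ γ⁻¹`. [folklore] -/
theorem opNorm_inv_regionDeltaLoc_le (ha' : 0 < a') {γ : ℝ} (hγ : 0 < γ) (h : Coercive (regionDeltaA n M a a' S) γ) :
    IsUnit (regionDeltaLoc n M a S).det ∧ ‖(regionDeltaLoc n M a S)⁻¹‖ ≤ γ⁻¹ :=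
  ⟨isUnit_det_of_coercive hγ (coercive_regionDeltaLoc_of n M a a' S ha' h),
    opNorm_inv_le_of_coercive hγ (coercive_regionDeltaLoc_of n M a a' S ha' h)⟩

/-- **THE GAUGE COLUMNS ARE ENERGY-BOUNDED, LEVEL-FREE**: `nsq (B̂ c) ≤ γ′⁻¹·nsq c`, `γ′ = gammaPs d a′` (`0 < a′`). [folklore] -/
theorem nsq_regionBh_mulVec_le (ha' : 0 < a') (c : {y // S y} → ℂ) :
    nsq (regionBh n M a' S *ᵥ c) ≤ (gammaPs d a')⁻¹ * nsq c := by
  have hn : (0 : ℝ) < (n : ℝ) ^ d := pow_pos (by exact_mod_cast Nat.pos_of_ne_zero (NeZero.ne n)) d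
  have hG : ‖GOm n M a' S‖ ≤ (gammaPs d a')⁻¹ := opNorm_inv_DOm_le n M a' (blockReg n M S) ha'
  have h1 := nsq_gaugeB_mulVec_le (gradR n M S) (GOm n M a' S) (QOm n M S) (DOm_mul_GOm n M a' S ha')
    (fun ψ => nsq_gradR_le_form_DOm n M a' S ha'.le ψ) (QOm_mul_conjTranspose n M S) c
  unfold regionBh
  rw [Matrix.smul_mulVec, nsq_smul, Complex.norm_real, Real.norm_of_nonneg (Real.sqrt_nonneg _), Real.sq_sqrt hn.le]
  calc (n : ℝ) ^ d * nsq (gaugeB (gradR n M S) (GOm n M a' S) (QOm n M S) *ᵥ c)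
      ≤ (n : ℝ) ^ d * (‖GOm n M a' S‖ * (((n : ℝ) ^ d)⁻¹ * nsq c)) := mul_le_mul_of_nonneg_left h1 hn.le
    _ = ‖GOm n M a' S‖ * nsq c := by field_simp
    _ ≤ (gammaPs d a')⁻¹ * nsq c := mul_le_mul_of_nonneg_right hG (nsq_nonneg _)

/-- `‖B̂‖ ≤ √(γ′⁻¹)`. [folklore] -/
theorem opNorm_regionBh_le (ha' : 0 < a') : ‖regionBh n M a' S‖ ≤ Real.sqrt ((gammaPs d a')⁻¹) :=
  opNorm_le_of_nsq_le_rect _ (Real.sqrt_nonneg _) fun c => by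
    rw [Real.sq_sqrt (inv_nonneg.mpr (gammaPs_pos (d := d) (a' := a')).1.le)]
    exact nsq_regionBh_mulVec_le n M a' S ha' c

/-- the gauge sandwich `E(Ω₀) = B̂·K̂⁻¹·B̂ᴴ` is bounded, level-free: `‖E‖ ≤ γ′⁻¹·σ₀⁻²`. [folklore] -/
theorem opNorm_gaugeE_le (ha' : 0 < a') :
    ‖regionBh n M a' S * (KcompR n M a' S)⁻¹ * (regionBh n M a' S)ᴴ‖ ≤ (gammaPs d a')⁻¹ * ((sigma0 d a') ^ 2)⁻¹ := by
  have hγ' : 0 ≤ (gammaPs d a')⁻¹ := inv_nonneg.mpr (gammaPs_pos (d := d) (a' := a')).1.le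
  have hB := opNorm_regionBh_le n M a' S ha'
  have hBt : ‖(regionBh n M a' S)ᴴ‖ ≤ Real.sqrt ((gammaPs d a')⁻¹) := by rw [Matrix.l2_opNorm_conjTranspose]; exact hB
  have hK := opNorm_KcompR_inv_le n M a' S ha'
  calc ‖regionBh n M a' S * (KcompR n M a' S)⁻¹ * (regionBh n M a' S)ᴴ‖
      ≤ ‖regionBh n M a' S * (KcompR n M a' S)⁻¹‖ * ‖(regionBh n M a' S)ᴴ‖ := Matrix.l2_opNorm_mul _ _
    _ ≤ ‖regionBh n M a' S‖ * ‖(KcompR n M a' S)⁻¹‖ * ‖(regionBh n M a' S)ᴴ‖ :=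
        mul_le_mul_of_nonneg_right (Matrix.l2_opNorm_mul _ _) (norm_nonneg _)
    _ ≤ Real.sqrt ((gammaPs d a')⁻¹) * ((sigma0 d a') ^ 2)⁻¹ * Real.sqrt ((gammaPs d a')⁻¹) := by gcongr
    _ = (gammaPs d a')⁻¹ * ((sigma0 d a') ^ 2)⁻¹ := by
        rw [mul_right_comm, Real.mul_self_sqrt hγ']

/-- **THE GAUGE SANDWICH AGAINST THE PROPAGATOR IS BOUNDED**: `Coercive Δ_a(Ω₀) γ` ⟹ `‖E·G‖ ≤ γ′⁻¹σ₀⁻²γ⁻¹` and `‖G·E‖ ≤ γ′⁻¹σ₀⁻²γ⁻¹`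
(`G = Δ_a(Ω₀)⁻¹`; on boxes γ = γ⋆ by W1, level-free). [folklore] -/
theorem opNorm_gaugeE_mul_inv_le (ha' : 0 < a') {γ : ℝ} (hγ : 0 < γ) (h : Coercive (regionDeltaA n M a a' S) γ) :
    ‖regionBh n M a' S * (KcompR n M a' S)⁻¹ * (regionBh n M a' S)ᴴ * (regionDeltaA n M a a' S)⁻¹‖
        ≤ (gammaPs d a')⁻¹ * ((sigma0 d a') ^ 2)⁻¹ * γ⁻¹ ∧
      ‖(regionDeltaA n M a a' S)⁻¹ * (regionBh n M a' S * (KcompR n M a' S)⁻¹ * (regionBh n M a' S)ᴴ)‖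
        ≤ (gammaPs d a')⁻¹ * ((sigma0 d a') ^ 2)⁻¹ * γ⁻¹ := by
  have hE := opNorm_gaugeE_le n M a' S ha'
  have hG : ‖(regionDeltaA n M a a' S)⁻¹‖ ≤ γ⁻¹ := opNorm_inv_le_of_coercive hγ h
  have h0 : 0 ≤ (gammaPs d a')⁻¹ * ((sigma0 d a') ^ 2)⁻¹ :=
    mul_nonneg (inv_nonneg.mpr (gammaPs_pos (d := d) (a' := a')).1.le) (inv_nonneg.mpr (sq_nonneg _))
  exact ⟨(Matrix.l2_opNorm_mul _ _).trans (mul_le_mul hE hG (norm_nonneg _) h0),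
    (Matrix.l2_opNorm_mul _ _).trans (by
      rw [mul_comm ((gammaPs d a')⁻¹ * ((sigma0 d a') ^ 2)⁻¹) γ⁻¹]
      exact mul_le_mul hG hE (norm_nonneg _) (inv_nonneg.mpr hγ.le))⟩

/-- **THE ONE-LEVEL RESOLVENT IDENTITIES FOR THE REGION**: `G = G̃ + G·E·G̃ = G̃ + G̃·E·G` with `G̃ = Δ_loc(Ω₀)⁻¹`, `E = B̂K̂⁻¹B̂ᴴ`
(`0 < a′`, `Δ_a(Ω₀)` coercive). [folklore] -/
theorem inv_regionDeltaA_eq (ha' : 0 < a') {γ : ℝ} (hγ : 0 < γ) (h : Coercive (regionDeltaA n M a a' S) γ) :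
    (regionDeltaA n M a a' S)⁻¹ = (regionDeltaLoc n M a S)⁻¹
        + (regionDeltaA n M a a' S)⁻¹ * (regionBh n M a' S * (KcompR n M a' S)⁻¹ * (regionBh n M a' S)ᴴ) * (regionDeltaLoc n M a S)⁻¹ ∧
      (regionDeltaA n M a a' S)⁻¹ = (regionDeltaLoc n M a S)⁻¹
        + (regionDeltaLoc n M a S)⁻¹ * (regionBh n M a' S * (KcompR n M a' S)⁻¹ * (regionBh n M a' S)ᴴ) * (regionDeltaA n M a a' S)⁻¹ :=
  ⟨inv_eq_inv_add_left (isUnit_det_of_coercive hγ h) (opNorm_inv_regionDeltaLoc_le n M a a' S ha' hγ h).1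
      (regionDeltaA_eq_loc_sub n M a a' S ha'),
    inv_eq_inv_add_right (isUnit_det_of_coercive hγ h) (opNorm_inv_regionDeltaLoc_le n M a a' S ha' hγ h).1
      (regionDeltaA_eq_loc_sub n M a a' S ha')⟩

end Region

end Summit.QuantumFields.BalabanUV.T4Continuum.RegionGaugeResolventSplit

end
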